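import Summits.KontsevichZagierPeriods.KontsevichZagierPeriods.Theses.AbelContraction
import Summits.KontsevichZagierPeriods.KontsevichZagierPeriods.Theorems.AbelContractionRealArcKernelStrength
import Literature.NumberTheory.Transcendental.KZCalculusProofs
import Literature.ModelTheory.ExponentialFields.TarskiSeidenbergProofs

/-!
# KontsevichZagierPeriods / AbelContraction — the BC2 redirect of the target `RealArcKernel`
# (item stmt-KontsevichZagierPeriods-12472; support file, lands `--supports`; split glue for
# `route edit --split RealArcKernel --into KZDimTwo ReductionToDimensionTwo --glue-by realArcKernel_of_subs`)

The target `RealArcKernel` (the kernel conjecture of the KZ calculus enlarged by the one-curve real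
hyperelliptic sector) is RESTATED: modulo the published theorem of Huber–Wüstholz (the tree's cite-only
fact `HuberWustholzCurvePeriods`, through the landed `planarAreas_of_huberWustholzCurvePeriods` and
`realArcKernel_iff_kontsevichZagierPeriods`) it is the summit. This file records its decomposition along
the input-dimension filtration, one OPEN layer up (route items of rev 8):

* `KZDimTwo` (stmt-4280, shared with HodgeLevel / BianchiHumbert / DessinsDimensionOne): Conjecture 1 on
  the dimension-two stratum — KZ-rational representations of dimensions `≤ 2` with equal values are
  KZ-equivalent;
* `ReductionToDimensionTwo` (stmt-18030): every subgroup `R ≥ KZ.relations` containing `[r] − [r′]` for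
  every equal-valued pair of KZ-rational representations of dimensions `≤ 2` contains `ker KZ.eval`.

Proved here, sorry-free:
* `realArcKernel_of_subs : KZDimTwo → ReductionToDimensionTwo → RealArcKernel` — the ASSEMBLY (pure
  logic: the stratum theorem feeds the hypothesis of the reduction; the sector hypothesis is discarded);
* `reductionToDimensionTwo_of_realArcKernel : RealArcKernel → ReductionToDimensionTwo` — piece 2 is
  NECESSARY (landed `reductionToDimensionOne_of_realArcKernel` + the monotonicity of the filtration
  `dimOne_pairs_of_dimTwo_pairs`: a one-dimensional pair is one Newton–Leibniz move away from a
  KZ-rational two-dimensional pair, `KZ.IntegralRep.graphRep`);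
* `reductionToDimensionTwo_on_dimLEOne` — piece 2 on the dimension-one part of the kernel (a special case
  proved now); `planarAreas_of_kzDimTwo : KZDimTwo → PlanarAreas` (the 1-period layer is inside the stratum),
  `kzDimTwo_of_kontsevichZagierPeriods`, `reductionToDimensionTwo_of_kontsevichZagierPeriods` (both
  pieces are consequences of the summit), `kontsevichZagierPeriods_of_subs` (jointly they decide it).

Deliberately NOT here: any attack on `KZDimTwo` or `ReductionToDimensionTwo` themselves, and no
conditional `iff` (piece 2 is equivalent to the summit only modulo the OPEN stratum `KZDimTwo`).

Sources: M. Kontsevich, D. Zagier, *Periods* (2001), §1.2 (rules (1)–(3), Conjecture 1);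
A. Huber, S. Müller-Stach, *Periods and Nori Motives* (2017), Conj. 13.2.1 (kernel form).
-/

noncomputable section

open Literature.NumberTheory.Transcendental
open Summit.KontsevichZagierPeriods.KontsevichZagierPeriods.Theses.AbelContraction
  (RealArcKernel PlanarAreas ReductionToDimensionOne KZDimTwo ReductionToDimensionTwo)

namespace Summit.KontsevichZagierPeriods.AbelContraction.RealArcKernelSplit

/-! ## The assembly -/

/-- **Assembly of the redirect** `KZDimTwo → ReductionToDimensionTwo → RealArcKernel`: given
`R ≥ KZ.relations`, Conjecture 1 on the stratum puts `[r] − [r′]` for every equal-valued KZ-rational pair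
of dimensions `≤ 2` inside `KZ.relations ≤ R`, and the reduction then puts `ker KZ.eval` inside `R`; the
sector hypothesis of the target is not consumed. [cite: KontsevichZagier2001, §1.2 Conjecture 1] -/
theorem realArcKernel_of_subs (h₂ : KZDimTwo) (hRed : ReductionToDimensionTwo) : RealArcKernel :=
  fun R hR _ x hx => hRed R hR (fun _ _ hn hm r r' hr hr' hv => hR (h₂ hn hm r r' hr hr' hv)) x hx

/-! ## Strength of the pieces -/

/-- The 1-period layer `PlanarAreas` (stmt-4990) is a special case of the stratum: the integrand `1` is
KZ-rational (`1 / 1`). [cite: KontsevichZagier2001, §1.1 Definition] -/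
theorem planarAreas_of_kzDimTwo (h₂ : KZDimTwo) : PlanarAreas := by
  intro r r' hr hr' hv
  refine h₂ le_rfl le_rfl r r' ⟨1, 1, fun _ _ => by simp, fun x hx => ?_⟩
    ⟨1, 1, fun _ _ => by simp, fun x hx => ?_⟩ hv
  · simp [hr x hx]
  · simp [hr' x hx]

/-- **Monotonicity of the input-dimension filtration.** If `R ≥ KZ.relations` contains `[s] − [s′]` for
every equal-valued pair of KZ-rational representations of dimensions `≤ 2`, then it contains `[r] − [r′]`
for every equal-valued pair of one-dimensional (semialgebraic) representations: `r` is one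
Newton–Leibniz move away from its volume-under-the-graph representation `KZ.IntegralRep.graphRep r`,
which is two-dimensional and KZ-rational, and equivalent representations have equal values.
[cite: KontsevichZagier2001, §1.1 remark after the Definition] -/
theorem dimOne_pairs_of_dimTwo_pairs {R : AddSubgroup KZ.FormalRep} (hR : KZ.relations ≤ R)
    (h : ∀ ⦃n m : ℕ⦄, n ≤ 2 → m ≤ 2 → ∀ (r : KZ.IntegralRep n) (r' : KZ.IntegralRep m),
      r.IsRational → r'.IsRational → r.value = r'.value → KZ.of r - KZ.of r' ∈ R) :
    ∀ (r r' : KZ.IntegralRep 1), r.value = r'.value → KZ.of r - KZ.of r' ∈ R := by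
  intro r r' hv
  have hTS : Literature.ModelTheory.ExponentialFields.tarski_seidenberg_real (k := ℚ) :=
    Literature.ModelTheory.ExponentialFields.tarski_seidenberg_real_holds
  have e : KZ.Equivalent r (r.graphRep hTS) := r.equivalent_graphRep hTS
  have e' : KZ.Equivalent r' (r'.graphRep hTS) := r'.equivalent_graphRep hTS
  have hv2 : (r.graphRep hTS).value = (r'.graphRep hTS).value := by
    rw [← KZ.Equivalent.value_eq_holds e, ← KZ.Equivalent.value_eq_holds e', hv]
  have h2 : KZ.of (r.graphRep hTS) - KZ.of (r'.graphRep hTS) ∈ R :=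
    h le_rfl le_rfl _ _ (r.isRational_graphRep hTS) (r'.isRational_graphRep hTS) hv2
  have : KZ.of r - KZ.of r' =
      (KZ.of r - KZ.of (r.graphRep hTS)) + (KZ.of (r.graphRep hTS) - KZ.of (r'.graphRep hTS)) -
        (KZ.of r' - KZ.of (r'.graphRep hTS)) := by abel
  rw [this]
  exact R.sub_mem (R.add_mem (hR e) h2) (hR e')

/-- Piece 2 follows from the reduction to dimension one (stmt-14403): monotonicity.
[cite: KontsevichZagier2001, §1.2] -/
theorem reductionToDimensionTwo_of_reductionToDimensionOne (h : ReductionToDimensionOne) :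
    ReductionToDimensionTwo :=
  fun R hR h2 x hx => h R hR (dimOne_pairs_of_dimTwo_pairs hR h2) x hx

/-- **Piece 2 is NECESSARY for the target**: `RealArcKernel → ReductionToDimensionTwo` (landed
`reductionToDimensionOne_of_realArcKernel`, p143402, then monotonicity). So no proof of the target avoids
stmt-18030. [cite: KontsevichZagier2001, §1.2 Conjecture 1] -/
theorem reductionToDimensionTwo_of_realArcKernel (h : RealArcKernel) : ReductionToDimensionTwo :=
  reductionToDimensionTwo_of_reductionToDimensionOne
    (Summit.KontsevichZagierPeriods.AbelContraction.RealArcKernelStrength.reductionToDimensionOne_of_realArcKernel h)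

/-- The summit implies piece 1 (restriction of Conjecture 1 to the stratum).
[cite: KontsevichZagier2001, §1.2 Conjecture 1] -/
theorem kzDimTwo_of_kontsevichZagierPeriods (h : KontsevichZagierPeriods) : KZDimTwo :=
  fun _ _ _ _ r r' hr hr' hv => h r r' hr hr' hv

/-- The summit implies piece 2 (through the target, `realArcKernel_of_kontsevichZagierPeriods`).
[cite: KontsevichZagier2001, §1.2 Conjecture 1] -/
theorem reductionToDimensionTwo_of_kontsevichZagierPeriods (h : KontsevichZagierPeriods) :
    ReductionToDimensionTwo :=
  reductionToDimensionTwo_of_realArcKernel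
    (Summit.KontsevichZagierPeriods.AbelContraction.RealArcKernelStrength.realArcKernel_of_kontsevichZagierPeriods h)

/-- The two pieces jointly decide the summit (assembly, then `realArcKernel_iff_kontsevichZagierPeriods`
fed with the 1-period layer, which piece 1 contains). Neither piece alone is known to.
[cite: KontsevichZagier2001, §1.2 Conjecture 1] -/
theorem kontsevichZagierPeriods_of_subs (h₂ : KZDimTwo) (hRed : ReductionToDimensionTwo) :
    KontsevichZagierPeriods :=
  (Summit.KontsevichZagierPeriods.AbelContraction.RealArcKernelStrength.realArcKernel_iff_kontsevichZagierPeriods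
    (planarAreas_of_kzDimTwo h₂)).mp (realArcKernel_of_subs h₂ hRed)

/-! ## A sorry-free special case of piece 2 -/

/-- **Piece 2 on the dimension-one part of the kernel** (special case, proved now): every value-`0`
`ℤ`-combination of one- and zero-dimensional representations lies in every `R ≥ KZ.relations` containing
the equal-valued KZ-rational pairs of dimensions `≤ 2` — the normal form inside dimension one
(`exists_sub_of_mem_closure_dimLEOne`, landed) followed by the monotonicity of the filtration.
[cite: KontsevichZagier2001, §1.2] -/
theorem reductionToDimensionTwo_on_dimLEOne :
    ∀ R : AddSubgroup KZ.FormalRep, KZ.relations ≤ R →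
      (∀ ⦃n m : ℕ⦄, n ≤ 2 → m ≤ 2 → ∀ (r : KZ.IntegralRep n) (r' : KZ.IntegralRep m),
        r.IsRational → r'.IsRational → r.value = r'.value → KZ.of r - KZ.of r' ∈ R) →
      ∀ x ∈ AddSubgroup.closure
          ({x : KZ.FormalRep | ∃ r : KZ.IntegralRep 1, x = KZ.of r} ∪
            {x : KZ.FormalRep | ∃ c : KZ.IntegralRep 0, x = KZ.of c}),
        KZ.eval x = 0 → x ∈ R := by
  intro R hR h2 x hx hx0
  obtain ⟨r, r', hrel⟩ :=
    Summit.KontsevichZagierPeriods.AbelContraction.RealArcKernelStrength.exists_sub_of_mem_closure_dimLEOne hx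
  have hker : KZ.eval (x - (KZ.of r - KZ.of r')) = 0 := KZ.relations_le_ker_eval_holds hrel
  rw [map_sub, hx0, zero_sub, neg_eq_zero, KZ.eval_of_sub_of, sub_eq_zero] at hker
  have hpair : KZ.of r - KZ.of r' ∈ R := dimOne_pairs_of_dimTwo_pairs hR h2 r r' hker
  have : x = (x - (KZ.of r - KZ.of r')) + (KZ.of r - KZ.of r') := by abel
  rw [this]
  exact R.add_mem (hR hrel) hpair

end Summit.KontsevichZagierPeriods.AbelContraction.RealArcKernelSplit

end
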